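import Summits.HodgeConjecture.CorCM.Census.OcticWeilOrbit
import HarnessLib

/-!
# The Galois orbit of a simple CM fourfold of Weil type (`E × B₁ × B₂ × B₃`): GENERATING PARTS of a balanced configuration
# (conjugate pairs; Weil `4`-sets of each `B_m`) and the induction principle

COR-CM (cell `pub-hodgecm2`), seat b30 gen 19 (2026-08-21); count-neutral own lane OCTIC-WEIL22, part ORBIT; sequel of
`Census/OcticWeilOrbit.lean` (26-point model, `ModelBalanced₃`, the defect law).  Bookkeeping definitions (`IsPairPart₃`,
`IsWeil₃Part`) and theorems of a finite model; no named fact, no geometry, no `sorry`.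

By the defect law (`exists_defect₃_of_modelBalanced₃`: `N(inl t) = N(inl f)` and `N(m,a,t) − N(m,a,f) = t_m` for all `a`)
a non-empty balanced configuration contains a pair part (two points over `{y, cj₃ y}`) or, for some type `m` with `t_m ≠ 0`,
a Weil part of type `m` (one point over each `(m, a, b)`, `b` the sign of `t_m`); removing it keeps the balance.  Hence the
INDUCTION PRINCIPLE `modelBalanced₃_induction`: every balanced configuration of a product of copies of `E, B₁, B₂, B₃` is a
disjoint union of pair parts and Weil parts of the three types — downstream: its weight line is a product of divisor lines and
lifted Weil lines `W_k(B_m)`, algebraic given Markman's fourfold theorem.  Pattern: `Census/OcticWeilFourfoldParts.lean`.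
[cite: Pohlmann1968, Thm 1] [cite: GaoUllmo2025, Thm 3.1] [cite: Dodson1984, §3.3.2 Theorem] [cite: MoonenZarhin1995Duke, Thm. 2.4]

## References
* [Pohlmann1968] H. Pohlmann, Ann. of Math. 88 (1968), Thm 1.  [GaoUllmo2025] Z. Gao, E. Ullmo, J. Inst. Math. Jussieu 25
  (2025), Thm 3.1.  [Dodson1984] B. Dodson, Trans. AMS 283 (1984), §3.3.2.  [MoonenZarhin1995Duke] Duke Math. J. 77 (1995),
  Thm. 2.4.  [Gordon1999HodgeAVSurvey] B. B. Gordon, CRM Monogr. 10 (1999), 5.13 (ii), 9.2.2.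
-/

namespace Summit.HodgeConjecture.CorCM.Census.OcticWeilOrbit

open Finset

variable {α : Type*} {v : α → Pt₃}

/-! ### The generating parts -/

/-- **A pair part**: two points over a conjugate pair of labels `{y, cj₃ y}` (a divisor weight, possibly spread over two
copies). [cite: Gordon1999HodgeAVSurvey, 9.2.2] -/
def IsPairPart₃ (v : α → Pt₃) (G : Finset α) : Prop :=
  ∃ y : Pt₃, G.card = 2 ∧ Set.InjOn v ↑G ∧ G.image v = {y, cj₃ y}

/-- **A Weil part of type `m` and sign `b`**: four points, one over each label `(m, a, b)` — a lift of the weight of the Weil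
line `⋀⁴ H¹(B_m)_b ⊆ W_k(B_m) ⊗ ℂ`. [cite: MoonenZarhin1995Duke, Thm. 2.4] [cite: Gordon1999HodgeAVSurvey, 5.13 (ii)] -/
def IsWeil₃Part (v : α → Pt₃) (m : Fin 3) (b : Bool) (G : Finset α) : Prop :=
  G.card = 4 ∧ ∀ a : Fin 4, (G.filter fun x => v x = Sum.inr (m, (a, b))).card = 1

/-- The count function of a pair part: `1` on `y` and `cj₃ y`, `0` elsewhere. [folklore] -/
theorem IsPairPart₃.count_eq [DecidableEq α] {G : Finset α} (hG : IsPairPart₃ v G) : ∃ y : Pt₃, ∀ z : Pt₃,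
    (G.filter fun x => v x = z).card = if z = y ∨ z = cj₃ y then 1 else 0 := by
  obtain ⟨y, hcard, hinj, himg⟩ := hG
  refine ⟨y, fun z => ?_⟩
  have hfib : ∀ z, (G.filter fun x => v x = z).card = if z ∈ G.image v then 1 else 0 := by
    intro z
    split_ifs with hz
    · obtain ⟨x, hx, rfl⟩ := Finset.mem_image.1 hz
      rw [Finset.card_eq_one]
      refine ⟨x, Finset.eq_singleton_iff_unique_mem.2 ⟨Finset.mem_filter.2 ⟨hx, rfl⟩, fun x' hx' => ?_⟩⟩
      exact hinj (Finset.mem_of_mem_filter _ hx') hx (Finset.mem_filter.1 hx').2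
    · rw [Finset.card_eq_zero, Finset.filter_eq_empty_iff]
      exact fun x hx hxz => hz (hxz ▸ Finset.mem_image_of_mem v hx)
  rw [hfib z, himg]
  simp only [Finset.mem_insert, Finset.mem_singleton]

/-- A sum over the model with at most the points `(m, a, b)`, `a < 4`, in its support. [folklore] -/
theorem sum_pt₃_of_support (N : Pt₃ → ℕ) (m : Fin 3) (b : Bool)
    (h : ∀ y : Pt₃, (∀ a : Fin 4, y ≠ Sum.inr (m, (a, b))) → N y = 0) :
    ∑ y : Pt₃, N y = ∑ a : Fin 4, N (Sum.inr (m, (a, b))) := by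
  classical
  have hinj : Function.Injective fun a : Fin 4 => (Sum.inr (m, (a, b)) : Pt₃) := fun a a' h => by
    simpa using h
  rw [← Finset.sum_image (f := N) (s := (univ : Finset (Fin 4))) (g := fun a => (Sum.inr (m, (a, b)) : Pt₃))
    fun a _ a' _ h => hinj h]
  symm
  refine Finset.sum_subset (Finset.subset_univ _) fun y _ hy => h y fun a hya => hy ?_
  rw [hya]
  exact Finset.mem_image_of_mem _ (Finset.mem_univ a)

/-- The count function of a Weil part of type `m`, sign `b`: `1` on the four `(m, a, b)`, `0` elsewhere. [folklore] -/
theorem IsWeil₃Part.count_eq {m : Fin 3} {b : Bool} {G : Finset α} (hG : IsWeil₃Part v m b G) (z : Pt₃) :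
    (G.filter fun x => v x = z).card = if ∃ a : Fin 4, z = Sum.inr (m, (a, b)) then 1 else 0 := by
  classical
  obtain ⟨hcard, hB⟩ := hG
  split_ifs with hz
  · obtain ⟨a, rfl⟩ := hz
    exact hB a
  · -- the four fibres over `(m, a, b)` exhaust `G`
    push Not at hz
    have htot := card_eq_sum₃ v G
    have hle : ∑ a : Fin 4, (G.filter fun x => v x = Sum.inr (m, (a, b))).card +
        (G.filter fun x => v x = z).card ≤ G.card := by
      have hdisj : ∀ a : Fin 4, Disjoint (G.filter fun x => v x = Sum.inr (m, (a, b))) (G.filter fun x => v x = z) :=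
        fun a => Finset.disjoint_filter.2 fun x _ h1 h2 => hz a (h2.symm.trans h1)
      have hpd : ∀ a ∈ (univ : Finset (Fin 4)), ∀ a' ∈ (univ : Finset (Fin 4)), a ≠ a' →
          Disjoint (G.filter fun x => v x = Sum.inr (m, (a, b))) (G.filter fun x => v x = Sum.inr (m, (a', b))) :=
        fun a _ a' _ haa => Finset.disjoint_filter.2 fun x _ h1 h2 => haa (by
          have := h1.symm.trans h2; simpa using this)
      rw [← Finset.card_biUnion hpd, ← Finset.card_union_of_disjoint
        ((Finset.disjoint_biUnion_left _ _ _).2 fun a _ => hdisj a)]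
      exact Finset.card_le_card (Finset.union_subset (Finset.biUnion_subset.2 fun a _ => Finset.filter_subset _ _)
        (Finset.filter_subset _ _))
    simp only [hB, Finset.sum_const, Finset.card_univ, Fintype.card_fin, smul_eq_mul, mul_one, hcard] at hle
    omega

/-- **A pair part is balanced.** [cite: Gordon1999HodgeAVSurvey, 9.2.2] -/
theorem IsPairPart₃.modelBalanced₃ [DecidableEq α] {G : Finset α} (hG : IsPairPart₃ v G) : ModelBalanced₃ v G := by
  obtain ⟨y, hy⟩ := hG.count_eq
  intro r
  rw [card_filter_mem_eq_sum₃, card_eq_sum₃ v G]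
  simp only [hy]
  have key : ∀ y : Pt₃, ∀ r : Fin 12, 2 * ∑ z ∈ phiTab r, (if z = y ∨ z = cj₃ y then 1 else 0) =
      ∑ z : Pt₃, (if z = y ∨ z = cj₃ y then 1 else 0) := by decide +kernel
  exact key y r

/-- **A Weil part is balanced** (the Weil line of `B_m` is a Hodge class for every conjugate type: two of the four labels
`(a, b)` lie in each `ρ_r⁻¹Φ_{I_m}`). [cite: MoonenZarhin1995Duke, Thm. 2.4] -/
theorem IsWeil₃Part.modelBalanced₃ {m : Fin 3} {b : Bool} {G : Finset α} (hG : IsWeil₃Part v m b G) :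
    ModelBalanced₃ v G := by
  classical
  intro r
  rw [card_filter_mem_eq_sum₃, card_eq_sum₃ v G]
  simp only [hG.count_eq]
  have key : ∀ (m : Fin 3) (b : Bool) (r : Fin 12),
      2 * ∑ z ∈ phiTab r, (if ∃ a : Fin 4, z = Sum.inr (m, (a, b)) then 1 else 0) =
        ∑ z : Pt₃, (if ∃ a : Fin 4, z = Sum.inr (m, (a, b)) then 1 else 0) := by decide +kernel
  exact key m b r

/-- A Weil part is non-empty. [folklore] -/
theorem IsWeil₃Part.nonempty {m : Fin 3} {b : Bool} {G : Finset α} (hG : IsWeil₃Part v m b G) : G.Nonempty := by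
  rw [← Finset.card_pos, hG.1]; norm_num

/-- A pair part is non-empty. [folklore] -/
theorem IsPairPart₃.nonempty {G : Finset α} (hG : IsPairPart₃ v G) : G.Nonempty := by
  obtain ⟨_, hcard, -⟩ := hG
  rw [← Finset.card_pos, hcard]; norm_num

/-- Every point of a Weil part of type `m`, sign `b` lies over a label `(m, a, b)`. [folklore] -/
theorem IsWeil₃Part.exists_eq_inr {m : Fin 3} {b : Bool} {G : Finset α} (hG : IsWeil₃Part v m b G) {x : α} (hx : x ∈ G) :
    ∃ a : Fin 4, v x = Sum.inr (m, (a, b)) := by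
  classical
  have hpos : 0 < (G.filter fun x' => v x' = v x).card := Finset.card_pos.2 ⟨x, Finset.mem_filter.2 ⟨hx, rfl⟩⟩
  rw [hG.count_eq] at hpos
  by_contra h
  rw [if_neg h] at hpos
  exact lt_irrefl 0 hpos

/-- The model map is injective on a Weil part. [folklore] -/
theorem IsWeil₃Part.injOn {m : Fin 3} {b : Bool} {G : Finset α} (hG : IsWeil₃Part v m b G) : Set.InjOn v ↑G := by
  classical
  intro x hx x' hx' hxx'
  obtain ⟨a, ha⟩ := hG.exists_eq_inr (Finset.mem_coe.1 hx)
  obtain ⟨z, hz⟩ := Finset.card_eq_one.1 (hG.2 a)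
  have hxz : x ∈ G.filter fun x => v x = Sum.inr (m, (a, b)) := Finset.mem_filter.2 ⟨Finset.mem_coe.1 hx, ha⟩
  have hx'z : x' ∈ G.filter fun x => v x = Sum.inr (m, (a, b)) :=
    Finset.mem_filter.2 ⟨Finset.mem_coe.1 hx', by rw [← hxx', ha]⟩
  rw [hz, Finset.mem_singleton] at hxz hx'z
  rw [hxz, hx'z]

/-- The model image of a Weil part of type `m`, sign `b` is the set of the four labels `(m, a, b)`. [folklore] -/
theorem IsWeil₃Part.image_eq [DecidableEq α] {m : Fin 3} {b : Bool} {G : Finset α} (hG : IsWeil₃Part v m b G) :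
    G.image v = (univ : Finset (Fin 4)).image fun a => (Sum.inr (m, (a, b)) : Pt₃) := by
  ext y
  simp only [Finset.mem_image, Finset.mem_univ, true_and]
  constructor
  · rintro ⟨x, hx, rfl⟩
    obtain ⟨a, ha⟩ := hG.exists_eq_inr hx
    exact ⟨a, ha.symm⟩
  · rintro ⟨a, rfl⟩
    obtain ⟨z, hz⟩ := Finset.card_eq_one.1 (hG.2 a)
    have hz' : z ∈ G.filter fun x => v x = Sum.inr (m, (a, b)) := by rw [hz]; exact Finset.mem_singleton_self z
    exact ⟨z, (Finset.mem_filter.1 hz').1, (Finset.mem_filter.1 hz').2⟩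

/-! ### Extraction of a generating part -/

/-- A Weil part inside `T` from the counts: one point over each `(m, a, b)`. [folklore] -/
theorem exists_weil₃Part_of_counts [DecidableEq α] {T : Finset α} (m : Fin 3) (b : Bool)
    (hB : ∀ a : Fin 4, 0 < (T.filter fun x => v x = Sum.inr (m, (a, b))).card) : ∃ G ⊆ T, IsWeil₃Part v m b G := by
  have hpick : ∀ a : Fin 4, ∃ x ∈ T, v x = Sum.inr (m, (a, b)) := fun a => by
    obtain ⟨x, hx⟩ := Finset.card_pos.1 (hB a)
    exact ⟨x, (Finset.mem_filter.1 hx).1, (Finset.mem_filter.1 hx).2⟩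
  choose pick hpickT hpickv using hpick
  have hpinj : Function.Injective pick := fun a a' h => by
    have e := hpickv a
    rw [h, hpickv a'] at e
    have : a' = a := by simpa using e
    exact this.symm
  refine ⟨univ.image pick, fun x hx => by obtain ⟨a, -, rfl⟩ := Finset.mem_image.1 hx; exact hpickT a, ?_, fun a => ?_⟩
  · rw [Finset.card_image_of_injective _ hpinj, Finset.card_univ, Fintype.card_fin]
  · rw [Finset.card_eq_one]
    refine ⟨pick a, ?_⟩
    ext x
    simp only [Finset.mem_filter, Finset.mem_image, Finset.mem_univ, true_and, Finset.mem_singleton]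
    constructor
    · rintro ⟨⟨a', rfl⟩, hvx⟩
      rw [hpickv a'] at hvx
      have : a' = a := by simpa using hvx
      rw [this]
    · rintro rfl
      exact ⟨⟨a, rfl⟩, hpickv a⟩

/-- A pair part inside `T` from the counts: one point over `y` and one over `cj₃ y`. [folklore] -/
theorem exists_pairPart₃_of_counts [DecidableEq α] {T : Finset α} (y : Pt₃)
    (hy : 0 < (T.filter fun x => v x = y).card) (hcy : 0 < (T.filter fun x => v x = cj₃ y).card) :
    ∃ G ⊆ T, IsPairPart₃ v G := by
  obtain ⟨x, hx₀⟩ := Finset.card_pos.1 hy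
  obtain ⟨hxT, hx⟩ := Finset.mem_filter.1 hx₀
  obtain ⟨x', hx₀'⟩ := Finset.card_pos.1 hcy
  obtain ⟨hx'T, hx'⟩ := Finset.mem_filter.1 hx₀'
  have hne : x ≠ x' := by
    intro h
    apply cj₃_facts.2 y
    rw [← hx', ← h, hx]
  refine ⟨{x, x'}, ?_, y, Finset.card_pair hne, ?_, ?_⟩
  · intro z hz
    rcases Finset.mem_insert.1 hz with rfl | hz
    · exact hxT
    · rw [Finset.mem_singleton.1 hz]; exact hx'T
  · intro z hz z' hz' hzz'
    simp only [Finset.coe_insert, Finset.coe_singleton, Set.mem_insert_iff, Set.mem_singleton_iff] at hz hz'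
    rcases hz with rfl | rfl <;> rcases hz' with rfl | rfl
    · rfl
    · exfalso; rw [hx, hx'] at hzz'; exact cj₃_facts.2 y hzz'.symm
    · exfalso; rw [hx, hx'] at hzz'; exact cj₃_facts.2 y hzz'
    · rfl
  · rw [Finset.image_insert, Finset.image_singleton, hx, hx']

/-- **EXTRACTION.**  A non-empty balanced configuration contains a pair part or a Weil part: by the defect law, if some
`t_m ≠ 0` then every `N(m, a, b) ≥ 1` for `b` the sign of `t_m` (a Weil part of type `m`); if all `t_m = 0` then — as always on
the curve — the conjugate of any hit label is hit (a pair part). [cite: Milne2020HodgeClassesAV, 1.2 (a) and Thm. 1]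
[cite: Dodson1984, §3.3.2 Theorem] -/
theorem exists_part_of_modelBalanced₃ [DecidableEq α] {T : Finset α} (hT : ModelBalanced₃ v T) (hne : T.Nonempty) :
    ∃ G ⊆ T, IsPairPart₃ v G ∨ ∃ m b, IsWeil₃Part v m b G := by
  obtain ⟨hEE, hB⟩ := exists_defect₃_of_modelBalanced₃ hT
  by_cases hpos : ∃ m : Fin 3, ∃ t : ℤ, 0 < t ∧ ∀ a : Fin 4, ((T.filter fun x => v x = Sum.inr (m, (a, true))).card : ℤ) -
      (T.filter fun x => v x = Sum.inr (m, (a, false))).card = t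
  · obtain ⟨m, t, ht, hBt⟩ := hpos
    obtain ⟨G, hG, hW⟩ := exists_weil₃Part_of_counts (v := v) (T := T) m true fun a => by have h := hBt a; omega
    exact ⟨G, hG, Or.inr ⟨m, true, hW⟩⟩
  by_cases hneg : ∃ m : Fin 3, ∃ t : ℤ, t < 0 ∧ ∀ a : Fin 4, ((T.filter fun x => v x = Sum.inr (m, (a, true))).card : ℤ) -
      (T.filter fun x => v x = Sum.inr (m, (a, false))).card = t
  · obtain ⟨m, t, ht, hBt⟩ := hneg
    obtain ⟨G, hG, hW⟩ := exists_weil₃Part_of_counts (v := v) (T := T) m false fun a => by have h := hBt a; omega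
    exact ⟨G, hG, Or.inr ⟨m, false, hW⟩⟩
  -- all `t_m = 0`: conjugation-invariant counts
  have h0 : ∀ (m : Fin 3) (a : Fin 4), (T.filter fun x => v x = Sum.inr (m, (a, true))).card =
      (T.filter fun x => v x = Sum.inr (m, (a, false))).card := by
    intro m a
    obtain ⟨t, hBt⟩ := hB m
    have ht0 : t = 0 := by
      by_contra ht
      rcases lt_or_gt_of_ne ht with h | h
      · exact hneg ⟨m, t, h, hBt⟩
      · exact hpos ⟨m, t, h, hBt⟩
    have h := hBt a
    omega
  obtain ⟨x, hx⟩ := hne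
  have hNx : 0 < (T.filter fun x' => v x' = v x).card := Finset.card_pos.2 ⟨x, Finset.mem_filter.2 ⟨hx, rfl⟩⟩
  have hNcx : 0 < (T.filter fun x' => v x' = cj₃ (v x)).card := by
    rcases hvx : v x with c | ⟨m, ⟨a, c⟩⟩ <;> rw [hvx] at hNx
    · cases c
      · rw [cj₃_inl, Bool.not_false]; omega
      · rw [cj₃_inl, Bool.not_true]; omega
    · have h := h0 m a
      cases c
      · rw [cj₃_inr, Bool.not_false]; omega
      · rw [cj₃_inr, Bool.not_true]; omega
  obtain ⟨G, hG, hP⟩ := exists_pairPart₃_of_counts (y := v x) hNx hNcx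
  exact ⟨G, hG, Or.inl hP⟩

/-! ### The induction principle -/

/-- **INDUCTION PRINCIPLE FOR BALANCED CONFIGURATIONS (any number of copies of `E, B₁, B₂, B₃`).**  Let `motive` hold for the
empty configuration and pass from `R` to `G ∪ R` whenever `G` is disjoint from `R` and is a pair part or a Weil part (of any
type and sign).  Then `motive` holds for every balanced configuration. [cite: Milne2020HodgeClassesAV, 1.2 (a) and Thm. 1]
[cite: GaoUllmo2025, Thm 3.1] -/
theorem modelBalanced₃_induction [DecidableEq α] {motive : Finset α → Prop} (h0 : motive ∅)
    (hpair : ∀ G R : Finset α, Disjoint G R → IsPairPart₃ v G → motive R → motive (G ∪ R))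
    (hweil : ∀ (G R : Finset α) (m : Fin 3) (b : Bool), Disjoint G R → IsWeil₃Part v m b G → motive R → motive (G ∪ R))
    {T : Finset α} (hT : ModelBalanced₃ v T) : motive T := by
  induction T using Finset.strongInduction with
  | H T ih =>
    by_cases hTe : T = ∅
    · subst hTe; exact h0
    obtain ⟨G, hGT, hG⟩ := exists_part_of_modelBalanced₃ hT (Finset.nonempty_iff_ne_empty.2 hTe)
    rcases hG with hP | ⟨m, b, hW⟩
    · have hR : ModelBalanced₃ v (T \ G) := hT.sdiff hP.modelBalanced₃ hGT
      have hlt : T \ G ⊂ T := Finset.sdiff_ssubset hGT hP.nonempty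
      have h := hpair G (T \ G) Finset.disjoint_sdiff hP (ih _ hlt hR)
      rwa [Finset.union_sdiff_of_subset hGT] at h
    · have hR : ModelBalanced₃ v (T \ G) := hT.sdiff hW.modelBalanced₃ hGT
      have hlt : T \ G ⊂ T := Finset.sdiff_ssubset hGT hW.nonempty
      have h := hweil G (T \ G) m b Finset.disjoint_sdiff hW (ih _ hlt hR)
      rwa [Finset.union_sdiff_of_subset hGT] at h

end Summit.HodgeConjecture.CorCM.Census.OcticWeilOrbit
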